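import Literature.Analysis.FunctionSpaces.DiagonalWeakLimits
import Mathlib.Analysis.InnerProductSpace.Dual
import Mathlib.Analysis.InnerProductSpace.Projection.Basic
import HarnessLib

/-!
# Bounded sequences in a Hilbert space have weakly convergent subsequences

Analysis/InnerProduct support file (everything proved; no definitions, no named facts): the
sequential Banach–Alaoglu / Eberlein–Šmulian statement for Hilbert spaces over `ℝ` or `ℂ`,

  `‖vₙ‖ ≤ M  ⇒  ∃ φ ↑, w, ‖w‖ ≤ M ∧ ∀ z, ⟪z, v_{φ n}⟫ → ⟪z, w⟫`

(`exists_strictMono_tendsto_inner_of_norm_le`), without any separability hypothesis on the space: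
Cantor's diagonal procedure on the countably many bounded scalar sequences `n ↦ ⟪vₘ, vₙ⟫`
(the tree's `Literature.Analysis.FunctionSpaces.exists_strictMono_forall_tendsto_real`, applied to
real and imaginary parts), extension of the convergence of the pairings from the span of the
sequence to its closure by equicontinuity (`‖vₙ‖ ≤ M`) and to all of `H` by the orthogonal
projection onto that closed subspace, and the Riesz representation of the limit functional
(`InnerProductSpace.toDual`). Textbook: Reed–Simon I, Thm. II.? / Conway, *A Course in Functional
Analysis*, V.§5; Robinson–Rodrigo–Sadowski (2016), Thm. 4.11 with Exercises 4.3–4.4 (the real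
case, followed by the tree's `DiagonalWeakLimits`). This is the compactness input for passing to
sharp-time (sharp-anchor) vectors in the Osterwalder–Schrader Hilbert space.

Everything here is tagged folklore.
-/

noncomputable section

open Filter Set Metric RCLike
open scoped _root_.Topology ComplexConjugate InnerProductSpace

namespace Literature.Analysis.InnerProduct

variable {𝕜 : Type*} [RCLike 𝕜] {H : Type*} [NormedAddCommGroup H] [InnerProductSpace 𝕜 H]

/-- Convergence of the pairings `⟪d, v n⟫` for `d ∈ D` propagates to the `𝕜`-span of `D`. [folklore] -/
theorem forall_span_exists_tendsto_inner {D : Set H} {v : ℕ → H}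
    (hconv : ∀ d ∈ D, ∃ l : 𝕜, Tendsto (fun n => ⟪d, v n⟫_𝕜) atTop (𝓝 l)) :
    ∀ d ∈ Submodule.span 𝕜 D, ∃ l : 𝕜, Tendsto (fun n => ⟪d, v n⟫_𝕜) atTop (𝓝 l) := by
  intro d hd
  induction hd using Submodule.span_induction with
  | mem d hd => exact hconv d hd
  | zero => exact ⟨0, by simp⟩
  | add a b _ _ ha hb =>
    obtain ⟨l₁, h₁⟩ := ha
    obtain ⟨l₂, h₂⟩ := hb
    exact ⟨l₁ + l₂, by simpa only [inner_add_left] using h₁.add h₂⟩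
  | smul c a _ ha =>
    obtain ⟨l, h⟩ := ha
    exact ⟨conj c * l, by simpa only [inner_smul_left] using h.const_mul (conj c)⟩

/-- For a **bounded** sequence, convergence of the pairings `⟪d, v n⟫`, `d ∈ D`, propagates to the
closure of the span of `D` (equicontinuity `|⟪z, v n⟫ − ⟪d, v n⟫| ≤ M ‖z − d‖`). [folklore] -/
theorem exists_tendsto_inner_of_mem_closure_span {D : Set H} {v : ℕ → H} {M : ℝ}
    (hM : ∀ n, ‖v n‖ ≤ M)
    (hconv : ∀ d ∈ D, ∃ l : 𝕜, Tendsto (fun n => ⟪d, v n⟫_𝕜) atTop (𝓝 l)) {z : H}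
    (hz : z ∈ closure (Submodule.span 𝕜 D : Set H)) :
    ∃ l : 𝕜, Tendsto (fun n => ⟪z, v n⟫_𝕜) atTop (𝓝 l) := by
  have hM0 : 0 ≤ M := (norm_nonneg _).trans (hM 0)
  refine Literature.Analysis.FunctionSpaces.forall_exists_tendsto_of_subset_closure
    (x := fun n z => ⟪z, v n⟫_𝕜) (S := closure (Submodule.span 𝕜 D : Set H))
    (D := (Submodule.span 𝕜 D : Set H)) subset_rfl (forall_span_exists_tendsto_inner hconv)
    (fun ε hε => ?_) z hz
  refine ⟨ε / (M + 1), by positivity, fun n t _ d _ htd => ?_⟩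
  rw [dist_eq_norm, ← inner_sub_left]
  calc ‖⟪t - d, v n⟫_𝕜‖ ≤ ‖t - d‖ * ‖v n‖ := norm_inner_le_norm _ _
    _ ≤ (ε / (M + 1)) * M := by
        rw [← dist_eq_norm]
        exact mul_le_mul htd.le (hM n) (norm_nonneg _) (by positivity)
    _ < ε := by
        rw [div_mul_eq_mul_div, div_lt_iff₀ (by positivity)]
        nlinarith

/-- **A bounded sequence in a Hilbert space has a weakly convergent subsequence** (over `ℝ` or `ℂ`,
no separability assumed): if `‖v n‖ ≤ M` then along some strictly increasing `φ` there is `w` with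
`‖w‖ ≤ M` and `⟪z, v (φ n)⟫ → ⟪z, w⟫` for every `z`. Proof: diagonal extraction makes the scalar
sequences `⟪v m, v (φ n)⟫` converge for every `m`; the convergence extends to the closed span `K`
of the sequence (boundedness) and to all `z` through the orthogonal projection onto `K`
(`⟪z − P_K z, v n⟫ = 0`); the limit is a bounded conjugate-linear functional of `z`, represented by
a vector `w` with `‖w‖ ≤ M` (Riesz). [folklore] -/
theorem exists_strictMono_tendsto_inner_of_norm_le [CompleteSpace H] {v : ℕ → H} {M : ℝ}
    (hM : ∀ n, ‖v n‖ ≤ M) :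
    ∃ (φ : ℕ → ℕ) (w : H), StrictMono φ ∧ ‖w‖ ≤ M ∧
      ∀ z : H, Tendsto (fun n => ⟪z, v (φ n)⟫_𝕜) atTop (𝓝 ⟪z, w⟫_𝕜) := by
  have hM0 : 0 ≤ M := (norm_nonneg _).trans (hM 0)
  -- (1) diagonal extraction on the real and imaginary parts of `⟪v m, v n⟫_𝕜`
  obtain ⟨φ, hφ, hconvφ⟩ := Literature.Analysis.FunctionSpaces.exists_strictMono_forall_tendsto_real
    (fun n (mb : ℕ × Bool) => if mb.2 then re ⟪v mb.1, v n⟫_𝕜 else im ⟪v mb.1, v n⟫_𝕜) (fun mb => by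
      refine ⟨M * M, fun n => ?_⟩
      have h : ‖⟪v mb.1, v n⟫_𝕜‖ ≤ M * M :=
        (norm_inner_le_norm _ _).trans (mul_le_mul (hM _) (hM _) (norm_nonneg _) hM0)
      split_ifs
      · exact (RCLike.abs_re_le_norm _).trans h
      · exact (RCLike.abs_im_le_norm _).trans h)
  set u : ℕ → H := fun n => v (φ n) with hu
  have huM : ∀ n, ‖u n‖ ≤ M := fun n => hM _
  -- the pairings with the `v m` converge along `φ`
  have hD : ∀ d ∈ Set.range v, ∃ l : 𝕜, Tendsto (fun n => ⟪d, u n⟫_𝕜) atTop (𝓝 l) := by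
    rintro _ ⟨m, rfl⟩
    obtain ⟨lr, hlr⟩ := hconvφ (m, true)
    obtain ⟨li, hli⟩ := hconvφ (m, false)
    simp only [ite_true] at hlr
    simp only [Bool.false_eq_true, ite_false] at hli
    refine ⟨(lr : 𝕜) + (li : 𝕜) * I, ?_⟩
    have h := ((RCLike.continuous_ofReal.tendsto lr).comp hlr).add
      (((RCLike.continuous_ofReal.tendsto li).comp hli).mul_const (I : 𝕜))
    refine h.congr fun n => ?_
    simp only [Function.comp_apply, hu]
    exact (re_add_im _)
  -- (2) the closed span `K` of the sequence and convergence for every `z`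
  set K : Submodule 𝕜 H := (Submodule.span 𝕜 (Set.range v)).topologicalClosure with hK
  have hKc : IsClosed (K : Set H) := Submodule.isClosed_topologicalClosure _
  haveI : CompleteSpace K := hKc.completeSpace_coe
  have huK : ∀ n, u n ∈ K := fun n =>
    Submodule.le_topologicalClosure _ (Submodule.subset_span ⟨φ n, rfl⟩)
  have hall : ∀ z, ∃ l : 𝕜, Tendsto (fun n => ⟪z, u n⟫_𝕜) atTop (𝓝 l) := by
    intro z
    have hPz : (K.starProjection z : H) ∈ closure (Submodule.span 𝕜 (Set.range v) : Set H) := by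
      have h : K.starProjection z ∈ (K : Set H) := Submodule.starProjection_apply_mem K z
      have hK' : (K : Set H) = closure (Submodule.span 𝕜 (Set.range v) : Set H) :=
        Submodule.topologicalClosure_coe _
      rwa [hK'] at h
    obtain ⟨l, hl⟩ := exists_tendsto_inner_of_mem_closure_span huM hD hPz
    refine ⟨l, hl.congr fun n => ?_⟩
    have h0 : ⟪z - K.starProjection z, u n⟫_𝕜 = 0 :=
      Submodule.starProjection_inner_eq_zero z (u n) (huK n)
    rw [inner_sub_left, sub_eq_zero] at h0
    exact h0.symm
  -- (3) the limit functional `z ↦ lim ⟪u n, z⟫_𝕜` is linear and bounded by `M`: Riesz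
  choose l hl using hall
  have hlin : ∀ z, Tendsto (fun n => ⟪u n, z⟫_𝕜) atTop (𝓝 (conj (l z))) := fun z => by
    have h := (RCLike.continuous_conj.tendsto (l z)).comp (hl z)
    refine h.congr fun n => ?_
    simp [Function.comp_apply, inner_conj_symm]
  let Lₗ : H →ₗ[𝕜] 𝕜 :=
    { toFun := fun z => conj (l z)
      map_add' := fun x y => tendsto_nhds_unique (hlin (x + y))
        (by simpa only [inner_add_right] using (hlin x).add (hlin y))
      map_smul' := fun c x => tendsto_nhds_unique (hlin (c • x))
        (by simpa only [inner_smul_right, smul_eq_mul, RingHom.id_apply] using (hlin x).const_mul c) }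
  have hLb : ∀ z, ‖Lₗ z‖ ≤ M * ‖z‖ := fun z =>
    le_of_tendsto ((continuous_norm.tendsto _).comp (hlin z)) (Eventually.of_forall fun n =>
      (norm_inner_le_norm _ _).trans (mul_le_mul_of_nonneg_right (huM n) (norm_nonneg _)))
  let L : StrongDual 𝕜 H := Lₗ.mkContinuous M hLb
  have hLnorm : ‖L‖ ≤ M := Lₗ.mkContinuous_norm_le hM0 hLb
  set w : H := (InnerProductSpace.toDual 𝕜 H).symm L with hw
  refine ⟨φ, w, hφ, ?_, fun z => ?_⟩
  · rw [hw, LinearIsometryEquiv.norm_map]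
    exact hLnorm
  · have h1 : ⟪w, z⟫_𝕜 = L z := by rw [hw, InnerProductSpace.toDual_symm_apply]
    have h2 : L z = conj (l z) := rfl
    have h3 : ⟪z, w⟫_𝕜 = l z := by
      rw [← inner_conj_symm, h1, h2, RCLike.conj_conj]
    rw [h3]
    exact hl z

end Literature.Analysis.InnerProduct
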